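import Summits.MatrixMultiplication.MatrixMultiplication.Theorems.OutsiderSandwichAmortised
import Summits.MatrixMultiplication.MatrixMultiplication.Theorems.OutsiderSandwichBorderExchange
import Summits.MatrixMultiplication.MatrixMultiplication.Theorems.OutsiderSandwichHalfMMFinite
import Literature.Computability.AlgebraicComplexity.KroneckerRank
import HarnessLib

/-!
# The cancelling pair: `⟨4⟩ ⊠ C₁ ⊵_deg ⟨3⟩ ⊠ ⟨2,2,2⟩` — degeneration beats restriction at level one

Route `OutsiderSandwich` (decomposition cell `decomp-mm`, lens 4 «minimal counterexample /
extremal reduction», gen 29), support for the aside leaf `BlockOneIsMM`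
(stmt-MatrixMultiplication-27147).

The amortised RESTRICTION table of the route has `a(1,3) = 5`
(`OutsiderSandwichLevelOne.amortisedNumber_one_three_eq`: four copies of the coupling
`C₁ ≅ P = [(X; u, w) ↦ (Xu, Xᵀw)]` do not restrict to three independent `2 × 2` matrix products).
This file shows that four copies DO DEGENERATE to three products, so the amortised BORDER table
starts strictly below the restriction table: `a̲(1,3) = 4 < 5 = a(1,3)` (the lower bound `4` is
`OutsiderSandwichBorderFloor.four_le_of_deg_three`).

**The gadget** (`isApproxRestriction`, an explicit first-order degeneration, BCS (15.19), with
`{0, ±1, ε}`-matrices).  Two copies `A, B` of `P` degenerate to `⟨2,2,2⟩ ⊕ ⟨2,1,2⟩`: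
substitute
  `X^A ↦ X + ε Rᵀ`, `X^B ↦ X` (matrix slot),
  `u^A ↦ Y e₀`, `w^A ↦ v`, `u^B ↦ Y e₁`, `w^B ↦ −v` (vector slot, `ε`-FREE),
  `(X^A u^A)^* ↦ ε Z^*e₀`, `(X^B u^B)^* ↦ ε Z^* e₁`, `(X^{A,B ᵀ} w)^* ↦ w'` (output slot);
then `ε⁰`: `vᵀXᵀw' − vᵀXᵀw' = 0` (the CANCELLING PAIR: the two transposed products `Xᵀ(±v)` share
the matrix and the output and cancel), `ε¹`: `tr(X Y Z^*) + vᵀ R w'` = `⟨2,2,2⟩ ⊕ ⟨2,1,2⟩`, and the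
`ε²`-terms are discarded.  Two such pairs give `2·⟨2,2,2⟩ ⊕ 2·⟨2,1,2⟩ ≥ 3·⟨2,2,2⟩` since
`⟨2,1,2⟩ ⊕ ⟨2,1,2⟩ ≥ ⟨2,1,2⟩ ⊠ ⟨1,2,1⟩ ≅ ⟨2,2,2⟩` (`⟨1,2,1⟩ ≤ ⟨2⟩`).

* `isApproxRestriction` — `⟨2⟩ ⊠ P ⊵₁ ⟨2,2,2⟩ ⊕ ⟨2,1,2⟩` (kernel-checked over `ℤ` by `decide` after
  contracting the `ε`-free slot, cast to `ℂ`; method of `CwSquareDegeneratesToMM223`);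
* `matMul212_directSum_restrictsTo_matMul222` — `⟨2,1,2⟩ ⊕ ⟨2,1,2⟩ ≥ ⟨2,2,2⟩`;
* `amortisedDeg_one_four_three` — **`⟨4⟩ ⊠ C₁^{⊠1} ⊵_deg ⟨3⟩ ⊠ ⟨2,2,2⟩^{⊠1}`**;
* `exchangeExponent_le_logb_four_thirds` — the datum in exponent form, `θ⋆ ≤ log₂(4/3)` (no record:
  `θ⋆ ≤ 0.37295` is known; recorded as the first rung of the border ladder).

## References
* P. Bürgisser, M. Clausen, M. A. Shokrollahi, *Algebraic Complexity Theory*, Springer 1997,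
  (15.19)–(15.26) (degeneration of order `h`), §15.6. [BurgisserClausenShokrollahi1997]
* D. Coppersmith, S. Winograd, *Matrix multiplication via arithmetic progressions*,
  J. Symbolic Comput. 9 (1990) 251–280, §7 (the coupling `C₁`). [CoppersmithWinograd1990]
* D. Bini, M. Capovani, G. Lotti, F. Romani, *`O(n^{2.7799})` complexity for `n × n` approximate
  matrix multiplication*, Inform. Process. Lett. 8 (1979) 234–235 (border rank beats rank for
  partial matrix products). [BiniCapovaniLottiRomani1979]
* M. Bläser, *Fast Matrix Multiplication*, Theory of Computing Library, Graduate Surveys 5 (2013),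
  §5.2, §6. [Blaser2013]
-/

noncomputable section

open scoped BigOperators Polynomial

set_option linter.dupNamespace false
set_option autoImplicit false

namespace Summit.MatrixMultiplication.MatrixMultiplication.Theorems.OutsiderSandwichCancellingPair

open Polynomial (C X)
open Literature.Computability.AlgebraicComplexity
open Summit.MatrixMultiplication.MatrixMultiplication.Theorems.OutsiderSandwichCoupling (coupling₁)
open Summit.MatrixMultiplication.MatrixMultiplication.Theorems.OutsiderSandwichBlockNormalForm
  (pairTensor pairTensor_restrictsTo_coupling₁ coupling₁_restrictsTo_pairTensor)
open Summit.MatrixMultiplication.MatrixMultiplication.Theorems.OutsiderSandwichAmortised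
  (mk_unit_kronecker_pow exchangeExponent_le_of_amortised)
open Summit.MatrixMultiplication.MatrixMultiplication.Theorems.OutsiderSandwichBorderExchange
  (restrictsTo_of_mk_eq)
open Summit.MatrixMultiplication.MatrixMultiplication.Theorems.OutsiderSandwichExchangeExponent
  (exchangeExponent)
open Summit.MatrixMultiplication.MatrixMultiplication.Theorems.OutsiderSandwichHalfMM
  (intCast_matMulTensor)

/-! ## 0. Index types and polynomial bookkeeping -/

/-- Source index of `⟨2⟩ ⊠ P`: copy, then `(row, col)` of the matrix slot / `(half, position)` of
the vector and output slots. -/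
abbrev I : Type := Fin 2 × (Fin 2 × Fin 2)

/-- Target first leg: `⟨2,2,2⟩`-forms `(κ, ν)` ⊕ `⟨2,1,2⟩`-forms `(κ, ν)`. -/
abbrev TA : Type := (Fin 2 × Fin 2) ⊕ (Fin 2 × Fin 2)

/-- Target second leg: `⟨2,2,2⟩`-variables `(κ, μ)` ⊕ `⟨2,1,2⟩`-variables `(κ, 0)`. -/
abbrev TB : Type := (Fin 2 × Fin 2) ⊕ (Fin 2 × Fin 1)

/-- Target third leg: `⟨2,2,2⟩`-variables `(μ, ν)` ⊕ `⟨2,1,2⟩`-variables `(0, ν)`. -/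
abbrev TC : Type := (Fin 2 × Fin 2) ⊕ (Fin 1 × Fin 2)

/-- the degree-`≤ 2` expansion of one summand. [folklore] -/
theorem term_expand (x0 x1 y0 y1 u : ℂ) :
    (C x0 + X * C x1) * (C y0 + X * C y1) * C u =
      C (x0 * y0 * u) + C ((x1 * y0 + x0 * y1) * u) * X + C (x1 * y1 * u) * X ^ 2 := by
  simp only [map_mul, map_add]
  ring

/-- its `ε⁰`-coefficient. [folklore] -/
theorem term_coeff_zero (x0 x1 y0 y1 u : ℂ) :
    ((C x0 + X * C x1) * (C y0 + X * C y1) * C u).coeff 0 = x0 * y0 * u := by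
  rw [term_expand, Polynomial.coeff_add, Polynomial.coeff_add, Polynomial.coeff_C,
    Polynomial.coeff_C_mul_X, Polynomial.coeff_C_mul_X_pow]
  simp

/-- its `ε¹`-coefficient. [folklore] -/
theorem term_coeff_one (x0 x1 y0 y1 u : ℂ) :
    ((C x0 + X * C x1) * (C y0 + X * C y1) * C u).coeff 1 = (x1 * y0 + x0 * y1) * u := by
  rw [term_expand, Polynomial.coeff_add, Polynomial.coeff_add, Polynomial.coeff_C,
    Polynomial.coeff_C_mul_X, Polynomial.coeff_C_mul_X_pow]
  simp

/-! ## 1. The integer tables of the gadget -/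

/-- the `0/1` host `⟨2⟩ ⊠ P` over `ℤ` (`P` the pair tensor of `(X; u, w) ↦ (Xu, Xᵀw)`). [new] -/
def hostZ (a y z : I) : ℤ :=
  if (a.1 = y.1 ∧ y.1 = z.1) ∧
      ((y.2.1 = 0 ∧ z.2.1 = 1 ∧ y.2.2 = a.2.2 ∧ z.2.2 = a.2.1) ∨
        (y.2.1 = 1 ∧ z.2.1 = 0 ∧ y.2.2 = a.2.1 ∧ z.2.2 = a.2.2)) then 1 else 0

/-- matrix slot, `ε⁰`-part: `X^A_{rc}, X^B_{rc} ↦ X_{rc}` (`⟨2,2,2⟩`-form `(κ,ν) = (c,r)`). [new] -/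
def a0 : TA → I → ℤ
  | Sum.inl q, a => if q.1 = a.2.2 ∧ q.2 = a.2.1 then 1 else 0
  | Sum.inr _, _ => 0

/-- matrix slot, `ε¹`-part: `X^A_{rc} ↦ ε R_{cr}` (`⟨2,1,2⟩`-form `(κ,ν) = (r,c)`). [new] -/
def a1 : TA → I → ℤ
  | Sum.inl _, _ => 0
  | Sum.inr q, a => if a.1 = 0 ∧ q.1 = a.2.1 ∧ q.2 = a.2.2 then 1 else 0

/-- vector slot (`ε`-free): `u^i_p ↦ Y_{p i}`, `w^A_p ↦ v_p`, `w^B_p ↦ −v_p`. [new] -/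
def bz : TB → I → ℤ
  | Sum.inl q, b => if b.2.1 = 0 ∧ q.1 = b.2.2 ∧ q.2 = b.1 then 1 else 0
  | Sum.inr q, b => if b.2.1 = 1 ∧ q.1 = b.2.2 then (if b.1 = 0 then 1 else -1) else 0

/-- output slot, `ε⁰`-part: `(X^{iᵀ} w^i)_p^* ↦ w'_p`. [new] -/
def c0 : TC → I → ℤ
  | Sum.inl _, _ => 0
  | Sum.inr q, c => if c.2.1 = 0 ∧ q.2 = c.2.2 then 1 else 0

/-- output slot, `ε¹`-part: `(X^i u^i)_p^* ↦ ε Z^*_{i p}` (`⟨2,2,2⟩`-variable `(μ,ν) = (i,p)`). [new] -/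
def c1 : TC → I → ℤ
  | Sum.inl q, c => if c.2.1 = 1 ∧ q.2 = c.2.2 ∧ q.1 = c.1 then 1 else 0
  | Sum.inr _, _ => 0

/-- closed form of the contraction of the host along the `ε`-free vector slot. [new] -/
def uT : TB → I → I → ℤ
  | Sum.inl q, a, c =>
      if a.1 = q.2 ∧ c.1 = q.2 ∧ c.2.1 = 1 ∧ q.1 = a.2.2 ∧ c.2.2 = a.2.1 then 1 else 0
  | Sum.inr q, a, c =>
      if c.1 = a.1 ∧ c.2.1 = 0 ∧ q.1 = a.2.1 ∧ c.2.2 = a.2.2 then (if a.1 = 0 then 1 else -1)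
      else 0

/-- the target `⟨2,2,2⟩ ⊕ ⟨2,1,2⟩` over `ℤ`. [new] -/
def tgtZ (a' : TA) (b' : TB) (c' : TC) : ℤ :=
  directSumTensor (matMulTensor ℤ 2 2 2) (matMulTensor ℤ 2 1 2) a' b' c'

set_option maxRecDepth 8000 in
/-- stage 1 (kernel): contracting the `ε`-free slot gives `uT`. [new] -/
theorem int_stage1 : ∀ (b' : TB) (a c : I),
    (∑ i : Fin 2, ∑ h : Fin 2, ∑ p : Fin 2, bz b' (i, (h, p)) * hostZ a (i, (h, p)) c) =
      uT b' a c := by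
  decide

set_option maxRecDepth 16000 in
/-- the `ε⁰`-coefficient vanishes identically (kernel): the cancelling pair. [new] -/
theorem int_identity_zero : ∀ (a' : TA) (b' : TB) (c' : TC),
    (∑ i : Fin 2, ∑ r : Fin 2, ∑ q : Fin 2, ∑ i' : Fin 2, ∑ h : Fin 2, ∑ p : Fin 2,
      a0 a' (i, (r, q)) * c0 c' (i', (h, p)) * uT b' (i, (r, q)) (i', (h, p))) = 0 := by
  decide

set_option maxRecDepth 16000 in
/-- the `ε¹`-coefficient is `⟨2,2,2⟩ ⊕ ⟨2,1,2⟩` (kernel). [new] -/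
theorem int_identity_one : ∀ (a' : TA) (b' : TB) (c' : TC),
    tgtZ a' b' c' =
      ∑ i : Fin 2, ∑ r : Fin 2, ∑ q : Fin 2, ∑ i' : Fin 2, ∑ h : Fin 2, ∑ p : Fin 2,
        (a1 a' (i, (r, q)) * c0 c' (i', (h, p)) + a0 a' (i, (r, q)) * c1 c' (i', (h, p))) *
          uT b' (i, (r, q)) (i', (h, p)) := by
  decide

/-! ## 2. The gadget over `ℂ` -/

/-- cast of the host: `hostZ = ⟨2⟩ ⊠ P`. [folklore] -/
theorem intCast_host (a y z : I) :
    ((hostZ a y z : ℤ) : ℂ) = kroneckerTensor (unitTensor ℂ 2) (pairTensor 2) a y z := by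
  simp only [hostZ, kroneckerTensor_apply, unitTensor_apply, pairTensor, ite_zero_mul_ite_zero,
    one_mul]
  split_ifs <;> simp

/-- cast of the target. [folklore] -/
theorem intCast_tgt : ∀ (a' : TA) (b' : TB) (c' : TC), ((tgtZ a' b' c' : ℤ) : ℂ) =
    directSumTensor (matMulTensor ℂ 2 2 2) (matMulTensor ℂ 2 1 2) a' b' c'
  | Sum.inl _, Sum.inl _, Sum.inl _ => by simp [tgtZ, intCast_matMulTensor]
  | Sum.inr _, Sum.inr _, Sum.inr _ => by simp [tgtZ, intCast_matMulTensor]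
  | Sum.inl _, Sum.inr _, _ => by simp [tgtZ]
  | Sum.inr _, Sum.inl _, _ => by simp [tgtZ]
  | Sum.inl _, Sum.inl _, Sum.inr _ => by show ((0 : ℤ) : ℂ) = 0; simp
  | Sum.inr _, Sum.inr _, Sum.inl _ => by show ((0 : ℤ) : ℂ) = 0; simp

/-- the polynomial matrix on the matrix slot (entries `0`, `1`, `ε`). [new] -/
def dA (a' : TA) (a : I) : ℂ[X] := C ((a0 a' a : ℤ) : ℂ) + X * C ((a1 a' a : ℤ) : ℂ)

/-- the constant matrix on the vector slot (entries `0`, `±1`). [new] -/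
def dB (b' : TB) (b : I) : ℂ[X] := C ((bz b' b : ℤ) : ℂ)

/-- the polynomial matrix on the output slot (entries `0`, `1`, `ε`). [new] -/
def dC (c' : TC) (c : I) : ℂ[X] := C ((c0 c' c : ℤ) : ℂ) + X * C ((c1 c' c : ℤ) : ℂ)

/-- stage 1 over `ℂ`. [new] -/
theorem stage1_C (b' : TB) (a c : I) :
    (∑ b : I, ((bz b' b : ℤ) : ℂ) * kroneckerTensor (unitTensor ℂ 2) (pairTensor 2) a b c) =
      ((uT b' a c : ℤ) : ℂ) := by
  have h := congrArg (fun z : ℤ => (z : ℂ)) (int_stage1 b' a c)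
  simpa only [Int.cast_sum, Int.cast_mul, intCast_host, Fintype.sum_prod_type] using h

/-- contracting the `ε`-free slot first. [new] -/
theorem sum_rewrite (a' : TA) (b' : TB) (c' : TC) :
    (∑ a, ∑ b, ∑ c, dA a' a * dB b' b * dC c' c *
        C (kroneckerTensor (unitTensor ℂ 2) (pairTensor 2) a b c)) =
      ∑ a, ∑ c, dA a' a * dC c' c * C (((uT b' a c : ℤ) : ℂ)) := by
  refine Finset.sum_congr rfl fun a _ => ?_
  rw [Finset.sum_comm]
  refine Finset.sum_congr rfl fun c _ => ?_
  rw [← stage1_C b' a c, map_sum, Finset.mul_sum]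
  refine Finset.sum_congr rfl fun b _ => ?_
  simp only [dB, map_mul]
  ring

/-- **`⟨2⟩ ⊠ P ⊵₁ ⟨2,2,2⟩ ⊕ ⟨2,1,2⟩`**: the cancelling-pair gadget is a first-order degeneration
(`IsApproxRestriction 1`, BCS (15.19)) by `{0, ±1, ε}`-matrices. [new] -/
theorem isApproxRestriction :
    IsApproxRestriction 1 (kroneckerTensor (unitTensor ℂ 2) (pairTensor 2))
      (directSumTensor (matMulTensor ℂ 2 2 2) (matMulTensor ℂ 2 1 2)) dA dB dC := by
  intro a' b' c' j hj
  rw [sum_rewrite]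
  rcases Nat.le_one_iff_eq_zero_or_eq_one.mp hj with rfl | rfl
  · simp only [Polynomial.finsetSum_coeff, dA, dC, term_coeff_zero]
    try rw [if_neg (by decide)]
    have h := congrArg (fun z : ℤ => (z : ℂ)) (int_identity_zero a' b' c')
    simpa only [Int.cast_sum, Int.cast_mul, Int.cast_zero, Fintype.sum_prod_type] using h
  · simp only [Polynomial.finsetSum_coeff, dA, dC, term_coeff_one]
    rw [if_pos trivial]
    have h := congrArg (fun z : ℤ => (z : ℂ)) (int_identity_one a' b' c')
    simpa only [Int.cast_sum, Int.cast_mul, Int.cast_add, intCast_tgt,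
      Fintype.sum_prod_type] using h.symm

/-- `⟨2⟩ ⊠ P ⊵ ⟨2,2,2⟩ ⊕ ⟨2,1,2⟩` (BCS (15.19) degeneration). [new] -/
theorem host_algDegeneratesTo :
    AlgDegeneratesTo (kroneckerTensor (unitTensor ℂ 2) (pairTensor 2))
      (directSumTensor (matMulTensor ℂ 2 2 2) (matMulTensor ℂ 2 1 2)) :=
  ⟨1, _, _, _, isApproxRestriction⟩

/-! ## 3. Gluing the two half products: `⟨2,1,2⟩ ⊕ ⟨2,1,2⟩ ≥ ⟨2,2,2⟩` -/

/-- `[⟨2,2,2⟩] = [⟨2,1,2⟩]·[⟨1,2,1⟩]` in `T(ℂ)` (matrix tensors multiply). [cite: Blaser2013, §5.2 p. 24] -/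
theorem mk_matMul222_eq_mul :
    TensorClass.mk (matMulTensor ℂ 2 2 2) =
      TensorClass.mk (matMulTensor ℂ 2 1 2) * TensorClass.mk (matMulTensor ℂ 1 2 1) := by
  rw [TensorClass.mk_mul_mk]
  have e : kroneckerTensor (matMulTensor ℂ 2 1 2) (matMulTensor ℂ 1 2 1) = fun a b c =>
      matMulTensor ℂ (2 * 1) (1 * 2) (2 * 1) (doubleIndexEquiv 2 2 1 1 a) (doubleIndexEquiv 2 1 1 2 b)
        (doubleIndexEquiv 1 2 2 1 c) := by
    funext a b c
    exact kroneckerTensor_matMulTensor ℂ 2 1 2 1 2 1 a b c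
  have h : TensorClass.mk (kroneckerTensor (matMulTensor ℂ 2 1 2) (matMulTensor ℂ 1 2 1)) =
      TensorClass.mk (matMulTensor ℂ (2 * 1) (1 * 2) (2 * 1)) := by
    rw [e, TensorClass.mk_reindex]
  exact h.symm

/-- `[⟨1,2,1⟩] ≤ 2` in `T(ℂ)` (`R⟨1,2,1⟩ ≤ 2`). [cite: BurgisserClausenShokrollahi1997, (14.19)] -/
theorem mk_matMul121_le_two : TensorClass.mk (matMulTensor ℂ 1 2 1) ≤ (2 : TensorClass ℂ) := by
  rw [show (2 : TensorClass ℂ) = ((2 : ℕ) : TensorClass ℂ) from rfl, TensorClass.natCast_eq_mk,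
    TensorClass.mk_le_mk_iff]
  exact tensorRestrictsTo_unitTensor_of_tensorRank_le _
    ((tensorRank_matMulTensor_le (K := ℂ) 1 2 1).trans (by norm_num))

/-- **`⟨2,1,2⟩ ⊕ ⟨2,1,2⟩ ≥ ⟨2,2,2⟩`**: two matrix–vector products with independent matrices restrict
to one `2 × 2` matrix product (identify the matrices). [cite: Blaser2013, §5.2] -/
theorem matMul212_directSum_restrictsTo_matMul222 :
    TensorRestrictsTo (directSumTensor (matMulTensor ℂ 2 1 2) (matMulTensor ℂ 2 1 2))
      (matMulTensor ℂ 2 2 2) := by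
  rw [← TensorClass.mk_le_mk_iff, ← TensorClass.mk_add_mk, ← mul_two, mk_matMul222_eq_mul]
  exact TensorClass.mul_le_mul le_rfl mk_matMul121_le_two

/-- **Degenerations of a common order add** (BCS (15.24)(3) at equal orders; block-diagonal
matrices).  Restated here for order-`1` data to keep this file independent of
`DegenerationDirectSum`. [cite: BurgisserClausenShokrollahi1997, Lemma (15.24)(3)] -/
theorem isApproxRestriction_directSum_same {ι κ μ ι' κ' μ' ι₁ κ₁ μ₁ ι₁' κ₁' μ₁' : Type}
    [Fintype ι] [Fintype κ] [Fintype μ] [Fintype ι₁] [Fintype κ₁] [Fintype μ₁] {h : ℕ}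
    {s : ι → κ → μ → ℂ} {t : ι' → κ' → μ' → ℂ} {s₁ : ι₁ → κ₁ → μ₁ → ℂ} {t₁ : ι₁' → κ₁' → μ₁' → ℂ}
    {A : ι' → ι → ℂ[X]} {B : κ' → κ → ℂ[X]} {D : μ' → μ → ℂ[X]} {A₁ : ι₁' → ι₁ → ℂ[X]}
    {B₁ : κ₁' → κ₁ → ℂ[X]} {D₁ : μ₁' → μ₁ → ℂ[X]}
    (hr : IsApproxRestriction h s t A B D) (hr₁ : IsApproxRestriction h s₁ t₁ A₁ B₁ D₁) :
    IsApproxRestriction h (directSumTensor s s₁) (directSumTensor t t₁)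
      (blockDiag A A₁) (blockDiag B B₁) (blockDiag D D₁) := by
  intro x y z j hj
  rcases x with a' | a' <;> rcases y with b' | b' <;> rcases z with c' | c'
  · simpa [Fintype.sum_sum_type] using hr a' b' c' j hj
  · simp [Fintype.sum_sum_type]
  · simp [Fintype.sum_sum_type]
  · simp [Fintype.sum_sum_type]
  · simp [Fintype.sum_sum_type]
  · simp [Fintype.sum_sum_type]
  · simp [Fintype.sum_sum_type]
  · simpa [Fintype.sum_sum_type] using hr₁ a' b' c' j hj

/-- Two cancelling pairs: `(⟨2⟩ ⊠ P) ⊕ (⟨2⟩ ⊠ P) ⊵ (⟨2,2,2⟩ ⊕ ⟨2,1,2⟩) ⊕ (⟨2,2,2⟩ ⊕ ⟨2,1,2⟩)`.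
[cite: BurgisserClausenShokrollahi1997, Prop. (15.25)] -/
theorem host_directSum_algDegeneratesTo :
    AlgDegeneratesTo
      (directSumTensor (kroneckerTensor (unitTensor ℂ 2) (pairTensor 2))
        (kroneckerTensor (unitTensor ℂ 2) (pairTensor 2)))
      (directSumTensor (directSumTensor (matMulTensor ℂ 2 2 2) (matMulTensor ℂ 2 1 2))
        (directSumTensor (matMulTensor ℂ 2 2 2) (matMulTensor ℂ 2 1 2))) :=
  ⟨1, _, _, _, isApproxRestriction_directSum_same isApproxRestriction isApproxRestriction⟩

/-! ## 4. `⟨4⟩ ⊠ C₁ ⊵_deg ⟨3⟩ ⊠ ⟨2,2,2⟩` -/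

/-- `⟨4⟩ ⊠ C₁^{⊠1} ≥ (⟨2⟩ ⊠ P) ⊕ (⟨2⟩ ⊠ P)` (an identity in `T(ℂ)`, `C₁ ≅ P`). [cite: Zuiddam2018, §2.3] -/
theorem source_restrictsTo_host_directSum :
    TensorRestrictsTo (kroneckerTensor (unitTensor ℂ 4) (kroneckerPow coupling₁ 1))
      (directSumTensor (kroneckerTensor (unitTensor ℂ 2) (pairTensor 2))
        (kroneckerTensor (unitTensor ℂ 2) (pairTensor 2))) := by
  refine restrictsTo_of_mk_eq ?_
  rw [← TensorClass.mk_add_mk, ← TensorClass.mk_mul_mk, mk_unit_kronecker_pow, pow_one,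
    ← TensorClass.natCast_eq_mk,
    TensorClass.mk_eq_mk coupling₁_restrictsTo_pairTensor pairTensor_restrictsTo_coupling₁]
  push_cast
  ring

/-- `(⟨2,2,2⟩ ⊕ ⟨2,1,2⟩) ⊕ (⟨2,2,2⟩ ⊕ ⟨2,1,2⟩) ≥ ⟨3⟩ ⊠ ⟨2,2,2⟩^{⊠1}`. [cite: Zuiddam2018, §2.3] -/
theorem tgt_directSum_restrictsTo :
    TensorRestrictsTo
      (directSumTensor (directSumTensor (matMulTensor ℂ 2 2 2) (matMulTensor ℂ 2 1 2))
        (directSumTensor (matMulTensor ℂ 2 2 2) (matMulTensor ℂ 2 1 2)))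
      (kroneckerTensor (unitTensor ℂ 3) (kroneckerPow (matMulTensor ℂ 2 2 2) 1)) := by
  rw [← TensorClass.mk_le_mk_iff, mk_unit_kronecker_pow, pow_one, ← TensorClass.mk_add_mk,
    ← TensorClass.mk_add_mk]
  have hG : TensorClass.mk (matMulTensor ℂ 2 2 2) ≤
      TensorClass.mk (matMulTensor ℂ 2 1 2) + TensorClass.mk (matMulTensor ℂ 2 1 2) := by
    rw [TensorClass.mk_add_mk, TensorClass.mk_le_mk_iff]
    exact matMul212_directSum_restrictsTo_matMul222
  calc ((3 : ℕ) : TensorClass ℂ) * TensorClass.mk (matMulTensor ℂ 2 2 2)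
      = (TensorClass.mk (matMulTensor ℂ 2 2 2) + TensorClass.mk (matMulTensor ℂ 2 2 2)) +
          TensorClass.mk (matMulTensor ℂ 2 2 2) := by push_cast; ring
    _ ≤ (TensorClass.mk (matMulTensor ℂ 2 2 2) + TensorClass.mk (matMulTensor ℂ 2 2 2)) +
          (TensorClass.mk (matMulTensor ℂ 2 1 2) + TensorClass.mk (matMulTensor ℂ 2 1 2)) :=
        TensorClass.add_le_add le_rfl hG
    _ = (TensorClass.mk (matMulTensor ℂ 2 2 2) + TensorClass.mk (matMulTensor ℂ 2 1 2)) +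
          (TensorClass.mk (matMulTensor ℂ 2 2 2) + TensorClass.mk (matMulTensor ℂ 2 1 2)) := by
        ring

/-- **`⟨4⟩ ⊠ C₁^{⊠1} ⊵_deg ⟨3⟩ ⊠ ⟨2,2,2⟩^{⊠1}`**: four coupled blocks DEGENERATE to three independent
`2 × 2` matrix products (they do not restrict to them: `a(1,3) = 5`). [new] -/
theorem amortisedDeg_one_four_three :
    AlgDegeneratesTo (kroneckerTensor (unitTensor ℂ 4) (kroneckerPow coupling₁ 1))
      (kroneckerTensor (unitTensor ℂ 3) (kroneckerPow (matMulTensor ℂ 2 2 2) 1)) :=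
  (source_restrictsTo_host_directSum.algDegeneratesTo_trans
    host_directSum_algDegeneratesTo).trans_restrictsTo tgt_directSum_restrictsTo

/-- The datum in exponent form: `θ⋆ ≤ log₂(4/3)` (the symmetric-core value, now realised by an
amortised BORDER certificate at level one; no record). [cite: Strassen1988, Thm. 3.8] -/
theorem exchangeExponent_le_logb_four_thirds : exchangeExponent ≤ Real.logb 2 (4 / 3) := by
  have h := exchangeExponent_le_of_amortised one_pos three_pos amortisedDeg_one_four_three
  norm_num at h
  exact h

end Summit.MatrixMultiplication.MatrixMultiplication.Theorems.OutsiderSandwichCancellingPair
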